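import Summits.ValiantsHypothesis.ValiantsHypothesis.Theorems.LacunarySymmetroidMatrixDescartesDoorA26WallBubblingBubblingInertiaClosed
import Summits.ValiantsHypothesis.ValiantsHypothesis.Theorems.LacunarySymmetroidMatrixDescartesDoorA26WallBubblingBubblingNormalisation

/-!
# Wall bubbling for `DoorA26` — the RELATIVE (D)-SIEVE: members of a merged DISJOINT class are of the class-sum order (inertia)

LINE / STUBS.  Crux `Theses.LacunarySymmetroid.DoorA26` (stmt-ValiantsHypothesis-19979; OPEN, typed, never asserted), line
`Cruxes/DoorA26/Lines/wall_bubbling.lean` (val-idea-15); serves `Stmt.weylFaces_wall` (rev-3 statement file `…wall_bubbling_ConfluentDoor.lean`: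
(W) where a Weyl coincidence meets a DISJOINT-type value wall), EXIT side.  At such a point two pair-sum classes `{k,l}`, `{m,n}` of four distinct
letters merge; the level bookkeeping of the (W) chain (W2: `…ClassMoments`, `…ClassTower`, `…LevelSelection`) controls CLASS SUMS by the cluster
scale `μ_ν` but not the individual MEMBERS of a merged class, and a large member pair `G_kl ≈ −G_mn ≫ μ` would open a confluent slot `t·e^{E t}`
in the limit (line lead, bus 2026-08-28T18:08Z).  This file shows that INERTIA forbids it (def-free, sequence currency of W3's engine):

* `realisable_blockRestrict_smul` — restricting a realisable matrix to a set of letters (zero elsewhere) and multiplying by ANY real scalar gives a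
  realisable matrix (letters `√|c|·S_x` on the block, `0` off it; the sign goes into `ε`); `realisable_classGram` — MERGING letters into class sums
  keeps realisability (`polar_finsetSum_sum`), so the sieve below applies verbatim to merged letters;
* `twoPos_disjointPattern`, `twoPos_neg_disjointPattern`, `not_realisable_disjointPattern` — the pattern `J = E_kl + E_lk − E_mn − E_nm` on four
  distinct letters has two orthogonal positive vectors (`e_k + e_l`, `e_m − e_n`) and so has `−J` (`e_k − e_l`, `e_m + e_n`), hence neither `J` nor
  `−J` is a symmetroid Gram (`not_twoPos_of_isSymGram`) and `J` is NOT realisable (`realisable_iff`) — the (D) obstruction of the line's first-order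
  sieve, isolated;
* **`relative_dSieve`** — along a sequence of realisable `G^ν` with a scale `μ_ν > 0`: if the diagonal entries and the four non-merged cross entries of
  the `{k,l,m,n}`-block are `O(μ)` and the merged SUM `G^ν_kl + G^ν_mn` is `O(μ)`, then `G^ν_kl` (hence `G^ν_mn`) is `O(μ)`.  Proof: otherwise divide the
  block by `σ_ν = G^ν_kl` along a subsequence with `|G^ν_kl|/μ_ν → ∞`; the normalised block is realisable and converges to `J`; `Realisable` is CLOSED
  (`realisable_of_tendsto`, chain B11) — contradiction.  (The (D) sieve `pureDSieve` made RELATIVE to a scale: the disjoint first-order pattern cannot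
  even appear as the LEADING part of the merged members.  At a MIXED wall the pattern `Eᵢᵢ − ½(E_kl + E_lk)` IS realisable — no analogue there.)

USE (paper, line lead's recipe 18:08Z / this seat's note 18:26Z + scope erratum 18:27Z): for a disjoint relation among the four NON-Weyl values at a
`weylFaces_wall` point every other entry of the block is a singleton class, so the hypotheses hold with `μ` = the cluster scale at ANY level, the
merged class's `t`-slot moment `(G_kl ε_kl + G_mn ε_mn)/μ → 0`, and the limit object keeps `≤ 20` slots ⇒ `≤ 19` zeros with multiplicity by
`…ConfluentCount` — no door on that sub-stratum, modulo the shared middle.  For a relation THROUGH the Weyl value (`e₀ + e_k = e_l + e_m`) apply the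
lemma to the MERGED Gram (`realisable_classGram`, Weyl pair `{i,j}` ↦ one letter `Sᵢ + Sⱼ`): its diagonal / non-merged entries are the triple and
doubleton CLASS SUMS (again `O(μ)`), so `G_ik + G_jk` and `G_lm` are `O(μ)` — paper consequence (this seat's note, bus 2026-08-28): with the
`t`-moment bound this gives `G_ik, G_jk = O(μ/w)` and the `t²`-moment of the merged class is `o(μ)`, i.e. again no extra slot.  The wiring of either
case into the (W) chain's tower currency is NOT in this file.
Nothing here bears on (W)/(M)/(R) themselves, on `DoorA26`, on `MatrixDescartes` (stmt-ValiantsHypothesis-18050) or on `VP ≠ VNP`; registers unchanged.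

Seat val-sym-door-p2 g12 (W1 #13), `--supports stmt-ValiantsHypothesis-19979 --as helper`. [folklore] inertia of Gram matrices in `ℝ^{1,2}`;
closedness of the realisable cone (chain B11). [this work] the relative form.
-/

-- `Summit.ValiantsHypothesis.ValiantsHypothesis.…` repeats a component by the D-0017 layout
-- (single-conjunct summit), which the `dupNamespace` linter flags; the name is mandated.
set_option linter.dupNamespace false

namespace Summit.ValiantsHypothesis.ValiantsHypothesis.Theorems.LacunarySymmetroidMatrixDescartes.WallBubbling.SecondOrder

open Matrix Finset Filter Topology
open scoped BigOperators
open Summit.ValiantsHypothesis.ValiantsHypothesis.Theorems.LacunarySymmetroidMatrixDescartes.WallBubbling.Bubbling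

/-! ## §1 Restriction and scaling of realisable matrices -/

/-- `polar (0, T) = 0`. [folklore] -/
theorem polar_zero_left' (T : Matrix (Fin 2) (Fin 2) ℝ) : polar 0 T = 0 := by
  rw [polar_apply]; simp

/-- **Restriction × scalar of a realisable matrix is realisable.**  For a realisable `G`, a set of letters `B` and any real `c`, the matrix equal to
`c · G` on `B × B` and `0` elsewhere is realisable. [folklore] -/
theorem realisable_blockRestrict_smul {G : Matrix (Fin 6) (Fin 6) ℝ} (hG : Realisable G) (B : Finset (Fin 6)) (c : ℝ) :
    Realisable (Matrix.of fun x y => if x ∈ B ∧ y ∈ B then c * G x y else 0) := by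
  classical
  -- first scale, then restrict
  obtain ⟨ε, S, hε, hS, hcG⟩ := realisable_smul c hG
  refine ⟨ε, fun x => if x ∈ B then S x else 0, hε, fun x => ?_, fun x y => ?_⟩
  · by_cases hx : x ∈ B
    · simp only [hx, if_true]; exact hS x
    · simp only [hx, if_false]; exact Matrix.isSymm_zero
  · rw [Matrix.of_apply]
    by_cases hx : x ∈ B <;> by_cases hy : y ∈ B
    · simp only [hx, hy, and_self, if_true]
      have := hcG x y
      rw [Matrix.smul_apply, smul_eq_mul] at this
      exact this
    · simp only [hx, hy, and_false, if_false, if_true]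
      rw [polar_comm, polar_zero_left', mul_zero]
    · simp only [hx, hy, false_and, if_false, if_true]
      rw [polar_zero_left', mul_zero]
    · simp only [hx, hy, and_self, if_false]
      rw [polar_zero_left', mul_zero]

/-- Additivity of the polar form in the first slot. [folklore] -/
theorem polar_add_left' (S S' T : Matrix (Fin 2) (Fin 2) ℝ) : polar (S + S') T = polar S T + polar S' T := by
  rw [polar_apply, polar_apply, polar_apply]
  simp only [Matrix.add_apply]
  ring

/-- The polar form of a finite sum of letters, first slot. [folklore] -/
theorem polar_finsetSum_left (A : Finset (Fin 6)) (S : Fin 6 → Matrix (Fin 2) (Fin 2) ℝ) (T : Matrix (Fin 2) (Fin 2) ℝ) :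
    polar (∑ a ∈ A, S a) T = ∑ a ∈ A, polar (S a) T := by
  classical
  induction A using Finset.induction_on with
  | empty => simp [polar_zero_left']
  | insert a A ha ih => rw [Finset.sum_insert ha, Finset.sum_insert ha, polar_add_left', ih]

/-- The polar form of two finite sums of letters (bilinearity). [folklore] -/
theorem polar_finsetSum_sum (A B : Finset (Fin 6)) (S : Fin 6 → Matrix (Fin 2) (Fin 2) ℝ) :
    polar (∑ a ∈ A, S a) (∑ b ∈ B, S b) = ∑ a ∈ A, ∑ b ∈ B, polar (S a) (S b) := by
  rw [polar_finsetSum_left]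
  refine Finset.sum_congr rfl fun a _ => ?_
  rw [polar_comm, polar_finsetSum_left]
  exact Finset.sum_congr rfl fun b _ => polar_comm _ _

/-- **Merging letters keeps realisability.**  For a realisable `G` and any assignment of letter CLASSES `cls : Fin 6 → Finset (Fin 6)`, the merged
Gram matrix `G' y z = Σ_{a ∈ cls y} Σ_{b ∈ cls z} G a b` is realisable (letters = class sums).  This is how the relative sieve below is applied to a
merged class THROUGH a Weyl value (merge the Weyl pair `{i,j}` into one letter). [folklore] -/
theorem realisable_classGram {G : Matrix (Fin 6) (Fin 6) ℝ} (hG : Realisable G) (cls : Fin 6 → Finset (Fin 6)) :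
    Realisable (Matrix.of fun y z => ∑ a ∈ cls y, ∑ b ∈ cls z, G a b) := by
  obtain ⟨ε, S, hε, hS, h⟩ := hG
  refine ⟨ε, fun y => ∑ a ∈ cls y, S a, hε, fun y => ?_, fun y z => ?_⟩
  · unfold Matrix.IsSymm
    rw [Matrix.transpose_sum]
    exact Finset.sum_congr rfl fun a _ => (hS a).eq
  · rw [Matrix.of_apply, polar_finsetSum_sum, Finset.mul_sum]
    refine Finset.sum_congr rfl fun a _ => ?_
    rw [Finset.mul_sum]
    exact Finset.sum_congr rfl fun b _ => h a b

/-! ## §2 The disjoint pattern is not realisable -/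

/-- The quadratic form of the disjoint pattern `J = E_kl + E_lk − E_mn − E_nm`. [folklore] -/
theorem disjointPattern_form (k l m n : Fin 6) (x y : Fin 6 → ℝ) :
    x ⬝ᵥ ((Matrix.of fun a b : Fin 6 =>
        (if a = k ∧ b = l then (1 : ℝ) else 0) + (if a = l ∧ b = k then 1 else 0)
        - (if a = m ∧ b = n then 1 else 0) - (if a = n ∧ b = m then 1 else 0)) *ᵥ y)
      = x k * y l + x l * y k - x m * y n - x n * y m := by
  classical
  have h : ∀ (a p q : Fin 6), (∑ b, (if a = p ∧ b = q then (1 : ℝ) else 0) * y b) = if a = p then y q else 0 := by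
    intro a p q
    by_cases hap : a = p
    · simp only [hap, true_and, ite_mul, one_mul, zero_mul, Finset.sum_ite_eq', Finset.mem_univ, if_true]
    · simp [hap]
  have key : ∀ a, (∑ b, ((if a = k ∧ b = l then (1 : ℝ) else 0) + (if a = l ∧ b = k then 1 else 0)
      - (if a = m ∧ b = n then 1 else 0) - (if a = n ∧ b = m then 1 else 0)) * y b)
      = (if a = k then y l else 0) + (if a = l then y k else 0) - (if a = m then y n else 0) - (if a = n then y m else 0) := by
    intro a
    simp only [add_mul, sub_mul, Finset.sum_add_distrib, Finset.sum_sub_distrib, h]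
  simp only [dotProduct, Matrix.mulVec, Matrix.of_apply]
  simp only [key, mul_add, mul_sub, Finset.sum_add_distrib, Finset.sum_sub_distrib, mul_ite, mul_zero, Finset.sum_ite_eq',
    Finset.mem_univ, if_true]

/-- `J` has two orthogonal positive vectors: `e_k + e_l`, `e_m − e_n`. [folklore] -/
theorem twoPos_disjointPattern (k l m n : Fin 6) (hkl : k ≠ l) (hkm : k ≠ m) (hkn : k ≠ n) (hlm : l ≠ m) (hln : l ≠ n) (hmn : m ≠ n) :
    TwoPos (Matrix.of fun a b : Fin 6 =>
        (if a = k ∧ b = l then (1 : ℝ) else 0) + (if a = l ∧ b = k then 1 else 0)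
        - (if a = m ∧ b = n then 1 else 0) - (if a = n ∧ b = m then 1 else 0)) := by
  refine ⟨fun a => (if a = k then 1 else 0) + (if a = l then 1 else 0),
    fun a => (if a = m then 1 else 0) - (if a = n then 1 else 0), ?_, ?_, ?_⟩ <;>
    rw [disjointPattern_form] <;>
    simp [hkl, hkm, hkn, hlm, hln, hmn, hkl.symm, hkm.symm, hkn.symm, hlm.symm, hln.symm, hmn.symm]

/-- `−J` has two orthogonal positive vectors: `e_k − e_l`, `e_m + e_n`. [folklore] -/
theorem twoPos_neg_disjointPattern (k l m n : Fin 6) (hkl : k ≠ l) (hkm : k ≠ m) (hkn : k ≠ n) (hlm : l ≠ m) (hln : l ≠ n) (hmn : m ≠ n) :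
    TwoPos (-(Matrix.of fun a b : Fin 6 =>
        (if a = k ∧ b = l then (1 : ℝ) else 0) + (if a = l ∧ b = k then 1 else 0)
        - (if a = m ∧ b = n then 1 else 0) - (if a = n ∧ b = m then 1 else 0))) := by
  refine ⟨fun a => (if a = k then 1 else 0) - (if a = l then 1 else 0),
    fun a => (if a = m then 1 else 0) + (if a = n then 1 else 0), ?_, ?_, ?_⟩ <;>
    rw [Matrix.neg_mulVec, dotProduct_neg, disjointPattern_form] <;>
    simp [hkl, hkm, hkn, hlm, hln, hmn, hkl.symm, hkm.symm, hkn.symm, hlm.symm, hln.symm, hmn.symm]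

/-- **The disjoint pattern is not realisable** (inertia `(2,2)` cannot occur in `ℝ^{1,2}` under either global sign). [folklore] -/
theorem not_realisable_disjointPattern (k l m n : Fin 6) (hkl : k ≠ l) (hkm : k ≠ m) (hkn : k ≠ n) (hlm : l ≠ m) (hln : l ≠ n)
    (hmn : m ≠ n) :
    ¬ Realisable (Matrix.of fun a b : Fin 6 =>
        (if a = k ∧ b = l then (1 : ℝ) else 0) + (if a = l ∧ b = k then 1 else 0)
        - (if a = m ∧ b = n then 1 else 0) - (if a = n ∧ b = m then 1 else 0)) := by
  intro h
  rcases (realisable_iff _).mp h with h1 | h1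
  · exact not_twoPos_of_isSymGram h1 (twoPos_disjointPattern k l m n hkl hkm hkn hlm hln hmn)
  · exact not_twoPos_of_isSymGram h1 (twoPos_neg_disjointPattern k l m n hkl hkm hkn hlm hln hmn)

/-! ## §3 The relative (D)-sieve -/

/-- **RELATIVE (D)-SIEVE.**  Let `G^ν` be realisable, `μ_ν > 0` a scale, and `k, l, m, n` four distinct letters.  If the diagonal entries
`G^ν_xx` (`x ∈ {k,l,m,n}`) and the non-merged cross entries `G^ν_km, G^ν_kn, G^ν_lm, G^ν_ln` are bounded by `C·μ_ν`, and the MERGED SUM satisfies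
`|G^ν_kl + G^ν_mn| ≤ C·μ_ν`, then the merged members are of the same order: `∃ C', ∀ ν, |G^ν_kl| ≤ C'·μ_ν`. [this work] -/
theorem relative_dSieve (G : ℕ → Matrix (Fin 6) (Fin 6) ℝ) (hG : ∀ ν, Realisable (G ν))
    (k l m n : Fin 6) (hkl : k ≠ l) (hkm : k ≠ m) (hkn : k ≠ n) (hlm : l ≠ m) (hln : l ≠ n) (hmn : m ≠ n)
    (μ : ℕ → ℝ) (hμ : ∀ ν, 0 < μ ν) (C : ℝ)
    (hdiag : ∀ ν, |G ν k k| ≤ C * μ ν ∧ |G ν l l| ≤ C * μ ν ∧ |G ν m m| ≤ C * μ ν ∧ |G ν n n| ≤ C * μ ν)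
    (hcross : ∀ ν, |G ν k m| ≤ C * μ ν ∧ |G ν k n| ≤ C * μ ν ∧ |G ν l m| ≤ C * μ ν ∧ |G ν l n| ≤ C * μ ν)
    (hsum : ∀ ν, |G ν k l + G ν m n| ≤ C * μ ν) :
    ∃ C' : ℝ, ∀ ν, |G ν k l| ≤ C' * μ ν := by
  classical
  by_contra hcon
  push Not at hcon
  -- a subsequence along which `|G_kl| / μ` exceeds every bound
  have hfreq : ∀ j : ℕ, ∃ ν, (j : ℝ) * μ ν < |G ν k l| := fun j => hcon j
  choose ν₀ hν₀ using hfreq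
  -- WLOG monotone: use `Filter.extraction_of_frequently_atTop` on the predicate `P ν := (j-dependent)`; simpler: work with `ν₀` directly
  -- ratios r_j := μ (ν₀ j) / G (ν₀ j) k l → 0
  have hGpos : ∀ j, 0 < |G (ν₀ j) k l| := fun j =>
    lt_of_le_of_lt (mul_nonneg (Nat.cast_nonneg j) (hμ _).le) (hν₀ j)
  have hGne : ∀ j, G (ν₀ j) k l ≠ 0 := fun j => abs_pos.mp (hGpos j)
  have hratio : Tendsto (fun j => μ (ν₀ j) / |G (ν₀ j) k l|) atTop (𝓝 0) := by
    -- `0 ≤ μ/|G_kl| ≤ 1/j` for `j ≥ 1`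
    refine squeeze_zero' (Eventually.of_forall fun j => div_nonneg (hμ _).le (abs_nonneg _)) ?_
      tendsto_one_div_atTop_nhds_zero_nat
    filter_upwards [eventually_ge_atTop 1] with j hj
    rw [div_le_iff₀ (hGpos j), one_div, ← div_eq_inv_mul]
    have hjpos : (0 : ℝ) < j := by exact_mod_cast hj
    rw [le_div_iff₀ hjpos]
    have := hν₀ j
    nlinarith [(hμ (ν₀ j)).le]
  -- the normalised, restricted matrices
  let B : Finset (Fin 6) := {k, l, m, n}
  let H : ℕ → Matrix (Fin 6) (Fin 6) ℝ := fun j =>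
    Matrix.of fun x y => if x ∈ B ∧ y ∈ B then (G (ν₀ j) k l)⁻¹ * G (ν₀ j) x y else 0
  have hHreal : ∀ j, Realisable (H j) := fun j => realisable_blockRestrict_smul (hG _) B _
  -- the limit pattern
  let J : Matrix (Fin 6) (Fin 6) ℝ := Matrix.of fun a b : Fin 6 =>
    (if a = k ∧ b = l then (1 : ℝ) else 0) + (if a = l ∧ b = k then 1 else 0)
      - (if a = m ∧ b = n then 1 else 0) - (if a = n ∧ b = m then 1 else 0)
  -- small entries: anything bounded by `C μ` tends to `0` after division by `G_kl`
  have hsmall : ∀ (f : ℕ → ℝ), (∀ ν, |f ν| ≤ C * μ ν) →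
      Tendsto (fun j => (G (ν₀ j) k l)⁻¹ * f (ν₀ j)) atTop (𝓝 0) := by
    intro f hf
    refine squeeze_zero_norm (fun j => ?_) (by simpa using hratio.const_mul |C|)
    rw [Real.norm_eq_abs, abs_mul, abs_inv]
    calc |G (ν₀ j) k l|⁻¹ * |f (ν₀ j)| ≤ |G (ν₀ j) k l|⁻¹ * (|C| * μ (ν₀ j)) := by
          refine mul_le_mul_of_nonneg_left ?_ (inv_nonneg.mpr (abs_nonneg _))
          exact (hf _).trans (mul_le_mul_of_nonneg_right (le_abs_self C) (hμ _).le)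
      _ = |C| * (μ (ν₀ j) / |G (ν₀ j) k l|) := by rw [div_eq_mul_inv]; ring
  -- symmetry of the realisable `G`
  have hsym : ∀ ν x y, G ν x y = G ν y x := fun ν x y => by
    obtain ⟨ε, S, -, -, h⟩ := hG ν
    rw [h x y, h y x, polar_comm]
  -- entrywise convergence `H j → J`
  have hlim : Tendsto H atTop (𝓝 J) := by
    refine tendsto_pi_nhds.mpr fun x => tendsto_pi_nhds.mpr fun y => ?_
    simp only [H, J, Matrix.of_apply]
    by_cases hx : x ∈ B
    · by_cases hy : y ∈ B
      · simp only [hx, hy, and_self, if_true]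
        have hxB : x = k ∨ x = l ∨ x = m ∨ x = n := by simpa [B] using hx
        have hyB : y = k ∨ y = l ∨ y = m ∨ y = n := by simpa [B] using hy
        -- case analysis on the 16 positions
        rcases hxB with hx' | hx' | hx' | hx' <;> rcases hyB with hy' | hy' | hy' | hy' <;> rw [hx', hy'] <;>
          simp only [hkl, hkm, hkn, hlm, hln, hmn, hkl.symm, hkm.symm, hkn.symm, hlm.symm, hln.symm, hmn.symm,
            and_true, and_false, if_true, if_false, add_zero, zero_add, sub_zero, zero_sub, and_self, sub_self]
        -- (k,k)
        · exact hsmall _ fun ν => (hdiag ν).1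
        -- (k,l)
        · exact tendsto_const_nhds.congr' (Eventually.of_forall fun j => (inv_mul_cancel₀ (hGne j)).symm)
        -- (k,m)
        · exact hsmall _ fun ν => (hcross ν).1
        -- (k,n)
        · exact hsmall _ fun ν => (hcross ν).2.1
        -- (l,k)
        · refine tendsto_const_nhds.congr' (Eventually.of_forall fun j => ?_)
          dsimp only
          rw [hsym _ l k]; exact (inv_mul_cancel₀ (hGne j)).symm
        -- (l,l)
        · exact hsmall _ fun ν => (hdiag ν).2.1
        -- (l,m)
        · exact hsmall _ fun ν => (hcross ν).2.2.1
        -- (l,n)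
        · exact hsmall _ fun ν => (hcross ν).2.2.2
        -- (m,k)
        · have := hsmall _ fun ν => (hcross ν).1
          exact this.congr' (Eventually.of_forall fun j => by dsimp only; rw [hsym _ m k])
        -- (m,l)
        · have := hsmall _ fun ν => (hcross ν).2.2.1
          exact this.congr' (Eventually.of_forall fun j => by dsimp only; rw [hsym _ m l])
        -- (m,m)
        · exact hsmall _ fun ν => (hdiag ν).2.2.1
        -- (m,n): `G_mn / G_kl = (G_kl + G_mn)/G_kl − 1 → −1`
        · have h1 := hsmall _ hsum
          have h2 : Tendsto (fun j => (G (ν₀ j) k l)⁻¹ * (G (ν₀ j) k l + G (ν₀ j) m n) - 1) atTop (𝓝 (0 - 1)) :=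
            h1.sub tendsto_const_nhds
          rw [zero_sub] at h2
          refine h2.congr' (Eventually.of_forall fun j => ?_)
          dsimp only
          have := hGne j
          field_simp
          ring
        -- (n,k)
        · have := hsmall _ fun ν => (hcross ν).2.1
          exact this.congr' (Eventually.of_forall fun j => by dsimp only; rw [hsym _ n k])
        -- (n,l)
        · have := hsmall _ fun ν => (hcross ν).2.2.2
          exact this.congr' (Eventually.of_forall fun j => by dsimp only; rw [hsym _ n l])
        -- (n,m)
        · have h1 := hsmall _ hsum
          have h2 : Tendsto (fun j => (G (ν₀ j) k l)⁻¹ * (G (ν₀ j) k l + G (ν₀ j) m n) - 1) atTop (𝓝 (0 - 1)) :=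
            h1.sub tendsto_const_nhds
          rw [zero_sub] at h2
          refine h2.congr' (Eventually.of_forall fun j => ?_)
          dsimp only
          have := hGne j
          rw [hsym _ n m]
          field_simp
          ring
        -- (n,n)
        · exact hsmall _ fun ν => (hdiag ν).2.2.2
      · simp only [hx, hy, and_false, if_false]
        have hyB : ¬ (y = k ∨ y = l ∨ y = m ∨ y = n) := by simpa [B] using hy
        push Not at hyB
        simp only [hyB.1, hyB.2.1, hyB.2.2.1, hyB.2.2.2, and_false, if_false, add_zero, sub_zero]
        exact tendsto_const_nhds
    · simp only [hx, false_and, if_false]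
      have hxB : ¬ (x = k ∨ x = l ∨ x = m ∨ x = n) := by simpa [B] using hx
      push Not at hxB
      simp only [hxB.1, hxB.2.1, hxB.2.2.1, hxB.2.2.2, false_and, if_false, add_zero, sub_zero]
      exact tendsto_const_nhds
  exact not_realisable_disjointPattern k l m n hkl hkm hkn hlm hln hmn (realisable_of_tendsto hHreal hlim)

end Summit.ValiantsHypothesis.ValiantsHypothesis.Theorems.LacunarySymmetroidMatrixDescartes.WallBubbling.SecondOrder
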